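/-
Copyright (c) 2026 the pub-hodgecm-mathlib formalisation cell (harness21).  Prover seat hodgecm-mathlib-F0P2-p09 (g0), re-dealt to L1
`stub_firstTermThetaPairing` (director s1969∕s1970: «p09 → the p20 file»); hLiu418 = `stmt-HodgeConjecture-24832`; I4-conv (F′-fact) FILE D0, corollary D0∘D.
-/
import Summits.HodgeConjecture.HodgeConjecture.Theorems.K2LiuKlingenFibreHaarPinned      -- ★ D0 (p861318): `exists_measurableEquiv_map_prod_eq_prod_rpMeasure`
import Summits.HodgeConjecture.HodgeConjecture.Theorems.K2LiuKlingenInnerSectionEuler     -- ★ FILE D (p861075): `integral_eq_mul_tprod_of_map_eq`, `hasProd_integral_of_map_eq`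
import HarnessLib

/-!
# Crux `HLiu418`, I4-conv (F′-fact), D0∘D — `K2LiuKlingenFibreEulerProduct`: THE EULER PRODUCT OF A FACTORIZABLE INTEGRAND OVER THE KLINGEN FIBRE `Y(𝔸) × 𝔸_L`
# `∫_{Y(𝔸) × 𝔸_L} F d(μ_Y ⊗ μ_T) = (∫ g dμ) · ∏'_{v∉S} ∫_{L⁺_v³} φ_v dν_v` for `F(q) = g((E q)_S) · ∏ᶠ_{v∉S} φ_v((E q)_v)` (★ FILE D at ★ D0's pin)

Cell `hodgecm-mathlib`, crux item hLiu418 = `stmt-HodgeConjecture-24832`; squad K2 ∕ K2Liu (re-dealt hand F0P2-p09 (g0), director s1970); LEAD F0P6-plan (g14); spec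
K2Liu-p14 (g3) I4-conv census `K2/K2Liu-p14/g3/CENSUS-I4conv-FprimeFact.K2Liu-p14-g3.md` §2 (FILE D + D0 ⇒ the place-by-place Euler product the assembly FILE E consumes).
THEOREMS ONLY (no `def`, no instance, no notation, no named-fact hypothesis, no `sorry`); lane `--supports stmt-HodgeConjecture-24832 --as helper`.

**`exists_coord_integral_eq_mul_tprod`** — ★ FILE D `K2LiuKlingenInnerSectionEuler.integral_eq_mul_tprod_of_map_eq` ∕ `hasProd_integral_of_map_eq` INSTANTIATED at ★ D0
`K2LiuKlingenFibreHaarPinned.exists_measurableEquiv_map_prod_eq_prod_rpMeasure`: for the quadratic coordinates `E` of the Klingen fibre (split at a finite set `S` of places of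
`L⁺`; its three coordinate formulas repeated in the conclusion) and the pinned `μ`, EVERY integrable `F : Y(𝔸) × 𝔸_L → ℂ` of shape (F) IN THE COORDINATES OF `E q` —
`F q = g (E q).1 * ∏ᶠ_{v∉S} φ_v ((E q).2 v)` with `φ_v ≡ 1` on `𝒪_v³` — satisfies `∫ F d(μ_Y ⊗ μ_T) = (∫ g dμ) · ∏'_{v∉S} ∫ φ_v dν_v` (the tensor being `μ ⊗ ∏'ν`-integrable),
and, when `g` is not a.e. zero, the Euler product `∏_{v∉S} ∫ φ_v dν_v` CONVERGES (`HasProd`).  No `E.symm` appears: FILE D's shape hypothesis `F (E.symm (x, y)) = …` is discharged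
by `E (E.symm (x, y)) = (x, y)`.  This is the form the assembly (census FILE E `K2LiuKlingenInnerSectionFactorizable`) and the local files B∕C plug into: `φ_v` = the local
Klingen fibre integrand at `v` (FILE B), `∫ φ_v dν_v = J_v = c_v(s) Λ^{line}_{s−½,v}` (FILE C). [CasselsFrohlichANT1967, Ch. XV (Tate) §3.3 Thm. 3.3.1], [BorelJacquet1979, §4.1].
HONEST LABEL.  Count-neutral helper: `HC_CM` is proved only modulo the 7 printed citations (2 remaining named inputs: hLiu418 = `stmt-HodgeConjecture-24832`,
h413 = `stmt-HodgeConjecture-24833`) until rung 0 closes; this file closes no socket by itself.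

## Mathlib ∕ tree search
Tree ★: D0 `exists_measurableEquiv_map_prod_eq_prod_rpMeasure`, D0 part 1 `coe_pi_integers_eq_integralBox`, FILE D `integral_eq_mul_tprod_of_map_eq` ∕ `hasProd_integral_of_map_eq`,
`FiniteAdeleFactorizable.isOpen_integralBox`, `AdelicSecondCountable.{countable_heightOneSpectrum, secondCountableTopology_adicCompletion}`.  Mathlib: `MeasurableEquiv.apply_symm_apply`,
`Pi.borelSpace`.  Dedup: `rg "coord_integral_eq_mul_tprod|KlingenFibreEuler" Summits/` — none.

## References
* [CasselsFrohlichANT1967] J. W. S. Cassels, A. Fröhlich (eds.), *Algebraic Number Theory* (1967), Ch. XV (Tate) §3.3 Thm. 3.3.1; Ch. II §14.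
* [BorelJacquet1979] A. Borel, H. Jacquet, *Automorphic forms and automorphic representations*, PSPM 33.1 (1979), §4.1.
-/

set_option autoImplicit false
set_option linter.dupNamespace false -- the mandated namespace repeats `HodgeConjecture.HodgeConjecture`

noncomputable section

open scoped RestrictedProduct ENNReal NNReal Topology
open NumberField IsDedekindDomain MeasureTheory Measure Filter Set

namespace Summit.HodgeConjecture.HodgeConjecture.Cruxes.HLiu418.K2LiuKlingenFibreEulerProduct

open Literature.NumberTheory.Automorphic Literature.NumberTheory.Automorphic.UnitaryGroup
open Literature.NumberTheory.GelbartRogawski1991.GRConstruction (Fp)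
open Literature.MeasureTheory.RestrictedProduct
open Summit.HodgeConjecture.HodgeConjecture.Cruxes.HLiu418.K2LiuKlingenFibreCoordinates
open Summit.HodgeConjecture.HodgeConjecture.Cruxes.HLiu418.K2LiuKlingenFibreHaarPinned
open Summit.HodgeConjecture.HodgeConjecture.Cruxes.HLiu418.K2LiuKlingenInnerSectionEuler

variable (L : Type) [Field L] [NumberField L] [IsCMField L]

/-- **THE EULER PRODUCT OVER THE KLINGEN FIBRE IN QUADRATIC COORDINATES** (★ FILE D at ★ D0's pin; statement in the header). [cite: CasselsFrohlichANT1967, Ch. XV (Tate) §3.3 Thm. 3.3.1] [cite: BorelJacquet1979, §4.1] -/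
theorem exists_coord_integral_eq_mul_tprod
    [MeasurableSpace (AdeleRing (𝓞 L) L)] [BorelSpace (AdeleRing (𝓞 L) L)]
    [MeasurableSpace (InfiniteAdeleRing (Fp L))] [BorelSpace (InfiniteAdeleRing (Fp L))]
    [∀ v : HeightOneSpectrum (𝓞 (Fp L)), MeasurableSpace (v.adicCompletion (Fp L))] [∀ v : HeightOneSpectrum (𝓞 (Fp L)), BorelSpace (v.adicCompletion (Fp L))]
    {δ : L} (hσδ : IsCMField.complexConj L δ = -δ) (hδ : δ ≠ 0)
    (Y : AddSubgroup (AdeleRing (𝓞 L) L)) (hY : ∀ y, y ∈ Y ↔ conjAdele (Fp L) L (IsCMField.complexConj L) y = -y)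
    (μY : Measure ↥Y) (μT : Measure (AdeleRing (𝓞 L) L)) [μY.IsAddHaarMeasure] [μT.IsAddHaarMeasure]
    (S : Finset (HeightOneSpectrum (𝓞 (Fp L))))
    (ν : ∀ v : HeightOneSpectrum (𝓞 (Fp L)), Measure (Fin 3 → v.adicCompletion (Fp L))) [∀ v, (ν v).IsAddHaarMeasure] [∀ v, SigmaFinite (ν v)]
    (hν : ∀ v, v ∉ S → ν v ((AddSubgroup.pi Set.univ (fun _ : Fin 3 => (v.adicCompletionIntegers (Fp L)).toSubring.toAddSubgroup) :
      AddSubgroup (Fin 3 → v.adicCompletion (Fp L))) : Set (Fin 3 → v.adicCompletion (Fp L))) = 1) :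
    ∃ E : (↥Y × AdeleRing (𝓞 L) L) ≃ᵐ
        ((Fin 3 → InfiniteAdeleRing (Fp L)) × (Π v : S, Fin 3 → v.1.adicCompletion (Fp L))) ×
        (Πʳ v : {v : HeightOneSpectrum (𝓞 (Fp L)) // v ∉ S},
          [Fin 3 → v.1.adicCompletion (Fp L), (AddSubgroup.pi Set.univ (fun _ : Fin 3 => (v.1.adicCompletionIntegers (Fp L)).toSubring.toAddSubgroup) :
            AddSubgroup (Fin 3 → v.1.adicCompletion (Fp L)))]),
      (∀ q, (E q).1.1 = ![((quadraticAdeleEquiv (Fp L) L (IsCMField.complexConj L) hσδ hδ).symm (q.1 : AdeleRing (𝓞 L) L)).2.1,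
        ((quadraticAdeleEquiv (Fp L) L (IsCMField.complexConj L) hσδ hδ).symm q.2).1.1,
        ((quadraticAdeleEquiv (Fp L) L (IsCMField.complexConj L) hσδ hδ).symm q.2).2.1]) ∧
      (∀ q (v : S), (E q).1.2 v = ![((quadraticAdeleEquiv (Fp L) L (IsCMField.complexConj L) hσδ hδ).symm (q.1 : AdeleRing (𝓞 L) L)).2.2 v.1,
        ((quadraticAdeleEquiv (Fp L) L (IsCMField.complexConj L) hσδ hδ).symm q.2).1.2 v.1,
        ((quadraticAdeleEquiv (Fp L) L (IsCMField.complexConj L) hσδ hδ).symm q.2).2.2 v.1]) ∧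
      (∀ q (v : {v : HeightOneSpectrum (𝓞 (Fp L)) // v ∉ S}), (E q).2 v =
        ![((quadraticAdeleEquiv (Fp L) L (IsCMField.complexConj L) hσδ hδ).symm (q.1 : AdeleRing (𝓞 L) L)).2.2 v.1,
          ((quadraticAdeleEquiv (Fp L) L (IsCMField.complexConj L) hσδ hδ).symm q.2).1.2 v.1,
          ((quadraticAdeleEquiv (Fp L) L (IsCMField.complexConj L) hσδ hδ).symm q.2).2.2 v.1]) ∧
      ∃ μ : Measure ((Fin 3 → InfiniteAdeleRing (Fp L)) × (Π v : S, Fin 3 → v.1.adicCompletion (Fp L))),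
        μ.IsAddHaarMeasure ∧ SigmaFinite μ ∧
        Measure.map E (μY.prod μT) =
          μ.prod (rpMeasure
            (fun v : {v : HeightOneSpectrum (𝓞 (Fp L)) // v ∉ S} =>
              ((AddSubgroup.pi Set.univ (fun _ : Fin 3 => (v.1.adicCompletionIntegers (Fp L)).toSubring.toAddSubgroup) :
                AddSubgroup (Fin 3 → v.1.adicCompletion (Fp L))) : Set (Fin 3 → v.1.adicCompletion (Fp L))))
            (fun v => ν v.1) ∅) ∧
        ∀ (F : ↥Y × AdeleRing (𝓞 L) L → ℂ) (g : (Fin 3 → InfiniteAdeleRing (Fp L)) × (Π v : S, Fin 3 → v.1.adicCompletion (Fp L)) → ℂ)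
          (φ : ∀ v : {v : HeightOneSpectrum (𝓞 (Fp L)) // v ∉ S}, (Fin 3 → v.1.adicCompletion (Fp L)) → ℂ),
          Integrable F (μY.prod μT) →
          (∀ (v : {v : HeightOneSpectrum (𝓞 (Fp L)) // v ∉ S}), ∀ k ∈ ((AddSubgroup.pi Set.univ (fun _ : Fin 3 => (v.1.adicCompletionIntegers (Fp L)).toSubring.toAddSubgroup) :
            AddSubgroup (Fin 3 → v.1.adicCompletion (Fp L))) : Set (Fin 3 → v.1.adicCompletion (Fp L))), φ v k = 1) →
          (∀ q, F q = g (E q).1 * ∏ᶠ v, φ v ((E q).2 v)) →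
          (Integrable (fun z : ((Fin 3 → InfiniteAdeleRing (Fp L)) × (Π v : S, Fin 3 → v.1.adicCompletion (Fp L))) ×
              (Πʳ v : {v : HeightOneSpectrum (𝓞 (Fp L)) // v ∉ S},
                [Fin 3 → v.1.adicCompletion (Fp L), (AddSubgroup.pi Set.univ (fun _ : Fin 3 => (v.1.adicCompletionIntegers (Fp L)).toSubring.toAddSubgroup) :
                  AddSubgroup (Fin 3 → v.1.adicCompletion (Fp L)))]) => g z.1 * ∏ᶠ v, φ v (z.2 v))
            (μ.prod (rpMeasure
              (fun v : {v : HeightOneSpectrum (𝓞 (Fp L)) // v ∉ S} =>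
                ((AddSubgroup.pi Set.univ (fun _ : Fin 3 => (v.1.adicCompletionIntegers (Fp L)).toSubring.toAddSubgroup) :
                  AddSubgroup (Fin 3 → v.1.adicCompletion (Fp L))) : Set (Fin 3 → v.1.adicCompletion (Fp L))))
              (fun v => ν v.1) ∅)) ∧
            ∫ q, F q ∂(μY.prod μT) = (∫ x, g x ∂μ) * ∏' v : {v : HeightOneSpectrum (𝓞 (Fp L)) // v ∉ S}, ∫ y, φ v y ∂(ν v.1)) ∧
          (¬ g =ᵐ[μ] 0 →
            Integrable (fun y : (Πʳ v : {v : HeightOneSpectrum (𝓞 (Fp L)) // v ∉ S},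
                [Fin 3 → v.1.adicCompletion (Fp L), (AddSubgroup.pi Set.univ (fun _ : Fin 3 => (v.1.adicCompletionIntegers (Fp L)).toSubring.toAddSubgroup) :
                  AddSubgroup (Fin 3 → v.1.adicCompletion (Fp L)))]) => ∏ᶠ v, φ v (y v))
              (rpMeasure
                (fun v : {v : HeightOneSpectrum (𝓞 (Fp L)) // v ∉ S} =>
                  ((AddSubgroup.pi Set.univ (fun _ : Fin 3 => (v.1.adicCompletionIntegers (Fp L)).toSubring.toAddSubgroup) :
                    AddSubgroup (Fin 3 → v.1.adicCompletion (Fp L))) : Set (Fin 3 → v.1.adicCompletion (Fp L))))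
                (fun v => ν v.1) ∅) ∧
            HasProd (fun v : {v : HeightOneSpectrum (𝓞 (Fp L)) // v ∉ S} => ∫ y, φ v y ∂(ν v.1))
              (∫ y, ∏ᶠ v, φ v (y v) ∂(rpMeasure
                (fun v : {v : HeightOneSpectrum (𝓞 (Fp L)) // v ∉ S} =>
                  ((AddSubgroup.pi Set.univ (fun _ : Fin 3 => (v.1.adicCompletionIntegers (Fp L)).toSubring.toAddSubgroup) :
                    AddSubgroup (Fin 3 → v.1.adicCompletion (Fp L))) : Set (Fin 3 → v.1.adicCompletion (Fp L))))
                (fun v => ν v.1) ∅))) := by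
  obtain ⟨E, hE1, hE2, hE3, μ, hμ, hσ, hmap⟩ :=
    exists_measurableEquiv_map_prod_eq_prod_rpMeasure L hσδ hδ Y hY μY μT S ν hν
  haveI := hμ
  haveI := hσ
  haveI : Countable (HeightOneSpectrum (𝓞 (Fp L))) := countable_heightOneSpectrum (Fp L)
  haveI : ∀ v : HeightOneSpectrum (𝓞 (Fp L)), SecondCountableTopology (v.adicCompletion (Fp L)) :=
    fun v => secondCountableTopology_adicCompletion (Fp L) v
  have hKne : ∀ v : {v : HeightOneSpectrum (𝓞 (Fp L)) // v ∉ S},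
      (((AddSubgroup.pi Set.univ (fun _ : Fin 3 => (v.1.adicCompletionIntegers (Fp L)).toSubring.toAddSubgroup) :
        AddSubgroup (Fin 3 → v.1.adicCompletion (Fp L))) : Set (Fin 3 → v.1.adicCompletion (Fp L)))).Nonempty :=
    fun v => ⟨0, AddSubgroup.zero_mem _⟩
  have hKm : ∀ v : {v : HeightOneSpectrum (𝓞 (Fp L)) // v ∉ S},
      MeasurableSet (((AddSubgroup.pi Set.univ (fun _ : Fin 3 => (v.1.adicCompletionIntegers (Fp L)).toSubring.toAddSubgroup) :
        AddSubgroup (Fin 3 → v.1.adicCompletion (Fp L))) : Set (Fin 3 → v.1.adicCompletion (Fp L)))) := fun v => by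
    rw [coe_pi_integers_eq_integralBox]
    exact (isOpen_integralBox (Fp L) (Fin 3) v.1).measurableSet
  refine ⟨E, hE1, hE2, hE3, μ, hμ, hσ, hmap, fun F g φ hFi hφK hF => ?_⟩
  have hF' : ∀ x (y : Πʳ v : {v : HeightOneSpectrum (𝓞 (Fp L)) // v ∉ S},
      [Fin 3 → v.1.adicCompletion (Fp L), (AddSubgroup.pi Set.univ (fun _ : Fin 3 => (v.1.adicCompletionIntegers (Fp L)).toSubring.toAddSubgroup) :
        AddSubgroup (Fin 3 → v.1.adicCompletion (Fp L)))]), F (E.symm (x, y)) = g x * ∏ᶠ v, φ v (y v) := fun x y => by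
    rw [hF, MeasurableEquiv.apply_symm_apply]
  exact ⟨integral_eq_mul_tprod_of_map_eq _ _ (μY.prod μT) μ hKne hKm (fun v => hν v.1 v.2) E hmap hFi g φ hφK hF',
    fun hg => hasProd_integral_of_map_eq _ _ (μY.prod μT) μ hKne hKm (fun v => hν v.1 v.2) E hmap hFi g hg φ hφK hF'⟩

end Summit.HodgeConjecture.HodgeConjecture.Cruxes.HLiu418.K2LiuKlingenFibreEulerProduct

end
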